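import Summits.ValiantsHypothesis.ValiantsHypothesis.Theorems.KSPipelineCeiling
import HarnessLib

/-!
# The Kumar–Saraf pipeline is closed for the permanent at door constant 2

File 2 of 2 (file 1 = `KSPipelineCeiling`); route `Depth4`, lens-4 «depth-reduction / chasm axis»
of the `decomp-valiant` workshop, generations 24–25 (OFFER O18), in support of
`stmt-ValiantsHypothesis-11333` (`Depth4HomFour`).  Sorry-free; no definition; no Literature fact.
FILE 1 isolated the technique class `KSCertifies f n s T` (= the tree's `KSCore01` with
`IMM ↦ f`, `⌈n^{ε√n}⌉ ↦ T`), proved its soundness for every homogeneous target and the COUNTING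
ceiling `T < N^((n-1)/(s+1))` (every `f` of degree `≤ n` on `N` variables).  Here:
* §3 the **planting ceiling for `per_n`**: if ALL `(s+1)`-subsets of the `n²` variables fit
  under the threshold (`C(n², s+1) ≤ T`), every admissible `ρ_{J,V}` keeps at most `s` non-unit
  variables, so `ρ_{J,V}(per_n)` has degree `≤ s` and its projected shifted partials never exceed
  ONE gate's bound: no certificate (`not_ksCertifies_perPoly_of_choose_le`);
* §4 the **crossing**: the two ceilings together exclude EVERY support threshold `s` once
  `T ≥ n^(2⌊√n⌋+2)` (`not_ksCertifies_perPoly`), in particular every door `(n+2)^(c⌊√n⌋+c)`,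
  `c ≥ 2` (`not_ksCertifies_perPoly_of_door_le`, `…_doorShape`).  A family of certificates at the
  doors `+ 1` is exactly what soundness would turn into the body of the crux `Depth4HomFour`
  (`depth4HomFour_shape_of_ksCertifies`); the closing pair `not_ksCertifies_family(')` records
  that the pipeline — `0/1`-substitution then a projected-shifted-partials count, with ANY
  `s, J, V, r, m, L` — cannot produce that crux.  BARRIER READING (unconditional, every field):
  `per_n` has `N = n²` variables against degree `n` (the planting wall); `IMM_{n^c,n}` escapes it
  only through `N = n^{2c+1}` variables.
SCOPE: the `0/1`-substitution + projected-shifted-partials pipeline in the tree's `KSCore01`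
currency ONLY — NOT covered: affine projections of partials (APP), lopsided / relative-rank
measures (LST), non-`0/1` substitutions, any post-processing other than the multilinear
projection.  NON-VACUITY: by citation only (Kumar–Saraf's `IMM` theorem; `KSCore01` is open in
the tree).  References: M. Kumar, S. Saraf, SIAM J. Comput. 46 (2017) 336–387, §5.1, §8, §10;
N. Kayal, R. Saptharishi, *A selection of lower bounds for arithmetic circuits* (2014), §5.
-/

set_option linter.dupNamespace false

noncomputable section

open MvPolynomial Literature.Computability.AlgebraicComplexity
open Literature.Computability.AlgebraicComplexity.KumarSaraf
open Literature.Computability.AlgebraicComplexity.GKKS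
open Summit.ValiantsHypothesis.ValiantsHypothesis.Theorems.KSPipelineCeiling

namespace Summit.ValiantsHypothesis.ValiantsHypothesis.Theorems.KSPipelinePer

variable {K : Type} [Field K] {σ : Type} [Fintype σ] [DecidableEq σ]

/-! ### §3 The planting ceiling for the permanent -/

omit [Fintype σ] in
/-- The `0/1`-substitution on a variable. [cite: KumarSaraf2017, §8.1 and §8.3] -/
theorem substVars_X (J V : Finset σ) (v : σ) :
    substVars J V (X v : MvPolynomial σ K) = if v ∈ J then 1 else if v ∈ V then X v else 0 := by
  unfold substVars
  exact aeval_X _ v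

omit [Fintype σ] in
/-- A substituted variable has degree `≤ 1` if kept and non-unit, `0` otherwise. [folklore] -/
theorem totalDegree_substVars_X_le (J V : Finset σ) (v : σ) :
    (substVars J V (X v : MvPolynomial σ K)).totalDegree ≤ if v ∈ V \ J then 1 else 0 := by
  rw [substVars_X]
  by_cases hJ : v ∈ J
  · rw [if_pos hJ, totalDegree_one]
    exact Nat.zero_le _
  · rw [if_neg hJ]
    by_cases hV : v ∈ V
    · rw [if_pos hV, if_pos (Finset.mem_sdiff.2 ⟨hV, hJ⟩)]
      exact (totalDegree_X (R := K) v).le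
    · rw [if_neg hV, totalDegree_zero]
      exact Nat.zero_le _

/-- **Planting bound**: under `ρ_{J,V}` every permutation monomial of `per` becomes the product of
the DISTINCT kept non-unit variables it meets (or `0`): `deg ρ_{J,V}(per) ≤ |V ∖ J|`. [folklore] -/
theorem totalDegree_substVars_perPoly_le {ν : Type} [Fintype ν] [DecidableEq ν]
    (J V : Finset (ν × ν)) :
    (substVars J V (perPoly ν K)).totalDegree ≤ (V \ J).card := by
  classical
  unfold perPoly Matrix.permanent
  rw [map_sum]
  refine (totalDegree_finsetSum _ _).trans (Finset.sup_le fun π _ => ?_)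
  show (substVars J V (∏ i, Matrix.mvPolynomialX ν ν K (π i) i)).totalDegree ≤ (V \ J).card
  rw [map_prod]
  refine (totalDegree_finsetProd _ _).trans ?_
  calc ∑ i, (substVars J V (Matrix.mvPolynomialX ν ν K (π i) i)).totalDegree
      ≤ ∑ i, (if (π i, i) ∈ V \ J then 1 else 0) := Finset.sum_le_sum fun i _ => by
        rw [Matrix.mvPolynomialX_apply]
        exact totalDegree_substVars_X_le J V (π i, i)
    _ = (Finset.univ.filter fun i => (π i, i) ∈ V \ J).card := by rw [Finset.card_filter]
    _ ≤ (V \ J).card := by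
        refine Finset.card_le_card_of_injOn (fun i => (π i, i)) ?_ ?_
        · intro i hi
          exact Finset.mem_coe.2 (Finset.mem_filter.1 (Finset.mem_coe.1 hi)).2
        · intro a _ b _ hab
          exact (Prod.ext_iff.1 hab).2

/-- **The adversary "all `(s+1)`-subsets"**: if no `(s+1)`-set avoiding `J` fits inside `V`,
then `|V ∖ J| ≤ s`. [folklore] -/
theorem card_sdiff_le_of_avoids {J V : Finset σ} {s : ℕ}
    (hV : ∀ A ∈ Finset.powersetCard (s + 1) (Finset.univ : Finset σ),
      s < (A \ J).card → ¬ (A \ J ⊆ V)) :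
    (V \ J).card ≤ s := by
  by_contra h
  obtain ⟨A, hA, hcard⟩ := Finset.exists_subset_card_eq (show s + 1 ≤ (V \ J).card by omega)
  have hAJ : A \ J = A :=
    Finset.sdiff_eq_self_of_disjoint (Finset.disjoint_of_subset_left hA Finset.sdiff_disjoint)
  refine hV A (Finset.mem_powersetCard.2 ⟨Finset.subset_univ _, hcard⟩) ?_ ?_
  · rw [hAJ, hcard]
    exact Nat.lt_succ_self s
  · rw [hAJ]
    exact hA.trans Finset.sdiff_subset

omit [DecidableEq σ] in
/-- A polynomial of degree `≤ s` never beats ONE gate: `Φ_{L,m}(g) ≤ #{A} · ∑_{i ≤ rs} C(N, m+i)`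
(order `r ≥ 1`: the degree cap of FILE 1; order `0`: single operator, `C(N, m)` generators).
[cite: KumarSaraf2017, §5.1] -/
theorem pspDim_le_gate_of_totalDegree_le (L : Finset (List σ)) {r : ℕ}
    (hL : ∀ l ∈ L, l.length = r) (m n s : ℕ) {g : MvPolynomial σ K} (hg : g.totalDegree ≤ s) :
    pspDim (fun l : L => (l : List σ)) m g ≤
      numSubsetsLE (2 * n / s + 1) r *
        ∑ i ∈ Finset.range (r * s + 1), (Fintype.card σ).choose (m + i) := by
  rcases Nat.eq_zero_or_pos r with rfl | hr
  · calc pspDim (fun l : L => (l : List σ)) m g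
        ≤ Fintype.card σ ^ 0 * (Fintype.card σ).choose m := pspDim_le_pow_mul_choose L hL m g
      _ = (Fintype.card σ).choose m := by rw [pow_zero, Nat.one_mul]
      _ ≤ _ := choose_le_gate n s 0 m
  · refine (pspDim_le_sum_choose_of_totalDegree_le (fun l : L => (l : List σ)) r
      (fun l => hL l l.2) m hg).trans (sum_choose_le_gate n s r m ?_)
    have := Nat.le_mul_of_pos_left s hr
    omega

/-- **PLANTING CEILING for `per_n`**: if `1 ≤ T` and all `(s+1)`-subsets of the `n²` variables fit
under the threshold, `C(n·n, s+1) ≤ T`, then NO Kumar–Saraf certificate with support threshold `s`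
exists for `per_n` (adversary: all `(s+1)`-subsets; `|V ∖ J| ≤ s`; degree `≤ s`). [folklore] -/
theorem not_ksCertifies_perPoly_of_choose_le {n s T : ℕ} (hT1 : 1 ≤ T)
    (hT : (n * n).choose (s + 1) ≤ T) :
    ¬ KSCertifies (perPoly (Fin n) K) n s T := by
  classical
  intro h
  obtain ⟨J, V, r, m, L, hL, hV, hbig⟩ :=
    h (Finset.powersetCard (s + 1) (Finset.univ : Finset (Fin n × Fin n)))
      (by rwa [Finset.card_powersetCard, Finset.card_univ, Fintype.card_prod, Fintype.card_fin])
  have hdeg : (substVars J V (perPoly (Fin n) K)).totalDegree ≤ s :=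
    (totalDegree_substVars_perPoly_le J V).trans (card_sdiff_le_of_avoids hV)
  have hlt := hbig.trans_le (pspDim_le_gate_of_totalDegree_le L hL m n s hdeg)
  exact absurd hlt (not_lt.2 (Nat.le_mul_of_pos_left _ hT1))

/-! ### §4 The crossing: no support threshold works beyond `n^(2⌊√n⌋+2)` -/
/-- `(n-1)/(s+1) ≤ ⌊√n⌋` once `s > ⌊√n⌋`. [folklore] -/
theorem pred_div_le_sqrt {n s : ℕ} (hs : Nat.sqrt n < s) : (n - 1) / (s + 1) ≤ Nat.sqrt n := by
  set q := Nat.sqrt n with hq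
  have h1 : n + 1 ≤ (q + 1) * (q + 1) := Nat.succ_le_succ_sqrt n
  have e1 : (q + 1) * (q + 1) = q * q + 2 * q + 1 := by ring
  have e2 : (q + 2) * q = q * q + 2 * q := by ring
  rw [e1] at h1
  calc (n - 1) / (s + 1) ≤ (n - 1) / (q + 2) := Nat.div_le_div_left (by omega) (by omega)
    _ ≤ q := Nat.div_le_of_le_mul (by rw [e2]; omega)

/-- `deg per_n ≤ n` (homogeneous of degree `n`). [cite: Burgisser2000, §2.1] -/
theorem totalDegree_perPoly_fin_le (n : ℕ) : (perPoly (Fin n) K).totalDegree ≤ n := by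
  have h := (perPoly_isHomogeneous (n := Fin n) (k := K)).totalDegree_le
  rwa [Fintype.card_fin] at h

/-- **THE CROSSING (uniform in the threshold)**: for `n ≥ 1` and `T ≥ n^(2⌊√n⌋+2)` NO support
threshold `s` admits a Kumar–Saraf certificate for `per_n`: for `s ≤ ⌊√n⌋` the planting ceiling
applies (`C(n², s+1) ≤ n^(2s+2) ≤ T`), for `s > ⌊√n⌋` the counting ceiling of FILE 1
(`(n²)^((n-1)/(s+1)) ≤ (n²)^⌊√n⌋ ≤ T`). [folklore] -/
theorem not_ksCertifies_perPoly {n T : ℕ} (hn : 1 ≤ n) (hT : n ^ (2 * Nat.sqrt n + 2) ≤ T)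
    (s : ℕ) : ¬ KSCertifies (perPoly (Fin n) K) n s T := by
  have hT1 : 1 ≤ T := (Nat.one_le_pow _ _ hn).trans hT
  by_cases hs : s ≤ Nat.sqrt n
  · refine not_ksCertifies_perPoly_of_choose_le hT1 (((Nat.choose_le_pow _ _).trans ?_).trans hT)
    rw [← Nat.pow_two, ← Nat.pow_mul]
    exact Nat.pow_le_pow_right hn (by omega)
  · push Not at hs
    refine not_ksCertifies_of_le (totalDegree_perPoly_fin_le n) ?_ ?_
    · rw [Fintype.card_prod, Fintype.card_fin]
      exact Nat.mul_pos hn hn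
    · rw [Fintype.card_prod, Fintype.card_fin]
      calc (n * n) ^ ((n - 1) / (s + 1)) ≤ (n * n) ^ Nat.sqrt n :=
            Nat.pow_le_pow_right (Nat.mul_pos hn hn) (pred_div_le_sqrt hs)
        _ = n ^ (2 * Nat.sqrt n) := by rw [← Nat.pow_two, ← Nat.pow_mul]
        _ ≤ n ^ (2 * Nat.sqrt n + 2) := Nat.pow_le_pow_right hn (Nat.le_add_right _ _)
        _ ≤ T := hT

/-- The door SHAPE dominates the crossing: `n^(2⌊√n⌋+2) ≤ (n+2)^(c⌊√n⌋+c)`, `c ≥ 2`. [folklore] -/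
theorem crossing_le_doorShape {n c : ℕ} (hc : 2 ≤ c) :
    n ^ (2 * Nat.sqrt n + 2) ≤ (n + 2) ^ (c * Nat.sqrt n + c) := by
  have h1 : 2 * Nat.sqrt n ≤ c * Nat.sqrt n := Nat.mul_le_mul_right _ hc
  calc n ^ (2 * Nat.sqrt n + 2) ≤ (n + 2) ^ (2 * Nat.sqrt n + 2) :=
        Nat.pow_le_pow_left (Nat.le_add_right n 2) _
    _ ≤ (n + 2) ^ (c * Nat.sqrt n + c) := Nat.pow_le_pow_right (by omega) (by omega)

/-- **BARRIER, door form**: for every `c ≥ 2`, every `n ≥ 1`, every threshold `T` at or above the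
door `(n+2)^(c⌊√n⌋+c)` and EVERY support threshold `s`: no Kumar–Saraf certificate that `per_n`
needs homogeneous `ΣΠΣΠ` size `T`. [folklore] -/
theorem not_ksCertifies_perPoly_of_door_le {n c T : ℕ} (hn : 1 ≤ n) (hc : 2 ≤ c)
    (hT : (n + 2) ^ (c * Nat.sqrt n + c) ≤ T) (s : ℕ) :
    ¬ KSCertifies (perPoly (Fin n) K) n s T :=
  not_ksCertifies_perPoly hn ((crossing_le_doorShape hc).trans hT) s

/-- **BARRIER, door-shape form**: for every `c ≥ 2`, `n ≥ 1`, `s`: no Kumar–Saraf certificate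
that `per_n` needs homogeneous `ΣΠΣΠ` size `(n+2)^(c⌊√n⌋+c)` (nor `… + 1`). [folklore] -/
theorem not_ksCertifies_perPoly_doorShape {n c : ℕ} (hn : 1 ≤ n) (hc : 2 ≤ c) (s e : ℕ)
    (_he : e ≤ 1) :
    ¬ KSCertifies (perPoly (Fin n) K) n s ((n + 2) ^ (c * Nat.sqrt n + c) + e) :=
  not_ksCertifies_perPoly_of_door_le hn hc (Nat.le_add_right _ _) s

/-- **What a family of certificates WOULD give** (soundness, FILE 1): certificates for `per_n` at
the thresholds `(n+2)^(c⌊√n⌋+c) + 1`, one `n ≥ 2` per `c`, yield the body of the crux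
`Depth4HomFour` (`stmt-ValiantsHypothesis-11333`):
`∀ c, ∃ n, (n+2)^(c⌊√n⌋+c) < homDepthFourCircuitSize per_n`.
[cite: KumarSaraf2017, Thm. 8.10 (proof)] -/
theorem depth4HomFour_shape_of_ksCertifies
    (h : ∀ c : ℕ, ∃ n s : ℕ, 2 ≤ n ∧ 1 ≤ s ∧
      KSCertifies (perPoly (Fin n) ℂ) n s ((n + 2) ^ (c * Nat.sqrt n + c) + 1)) :
    ∀ c : ℕ, ∃ n : ℕ,
      ((n + 2 : ℕ∞) ^ (c * Nat.sqrt n + c)) < homDepthFourCircuitSize (perPoly (Fin n) ℂ) := by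
  intro c
  obtain ⟨n, s, hn, hs, hks⟩ := h c
  refine ⟨n, ?_⟩
  have hhom : (perPoly (Fin n) ℂ).IsHomogeneous n := by
    have h' := perPoly_isHomogeneous (n := Fin n) (k := ℂ)
    rwa [Fintype.card_fin] at h'
  have hle := le_homDepthFourCircuitSize_of_ksCertifies hhom hn hs hks
  have hlt : ((n + 2 : ℕ∞) ^ (c * Nat.sqrt n + c)) <
      (((n + 2) ^ (c * Nat.sqrt n + c) + 1 : ℕ) : ℕ∞) := by
    exact_mod_cast lt_add_one ((n + 2) ^ (c * Nat.sqrt n + c))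
  exact hlt.trans_le hle

/-- **BARRIER (crux-facing)**: there is NO family of Kumar–Saraf certificates for `per` at the
doors `+ 1` — already `c = 2` has none, at any `n ≥ 1` and any support threshold. [folklore] -/
theorem not_ksCertifies_family :
    ¬ ∀ c : ℕ, ∃ n s : ℕ, 1 ≤ n ∧
      KSCertifies (perPoly (Fin n) K) n s ((n + 2) ^ (c * Nat.sqrt n + c) + 1) := by
  intro h
  obtain ⟨n, s, hn, hks⟩ := h 2
  exact not_ksCertifies_perPoly_of_door_le (c := 2) hn le_rfl (Nat.le_add_right _ _) s hks

/-- The same with the side conditions of `depth4HomFour_shape_of_ksCertifies` (`n ≥ 2`, `s ≥ 1`):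
its hypothesis is unsatisfiable — the pipeline cannot produce `Depth4HomFour`. [folklore] -/
theorem not_ksCertifies_family' :
    ¬ ∀ c : ℕ, ∃ n s : ℕ, 2 ≤ n ∧ 1 ≤ s ∧
      KSCertifies (perPoly (Fin n) K) n s ((n + 2) ^ (c * Nat.sqrt n + c) + 1) := by
  intro h
  refine not_ksCertifies_family (K := K) fun c => ?_
  obtain ⟨n, s, hn, -, hks⟩ := h c
  exact ⟨n, s, by omega, hks⟩

end Summit.ValiantsHypothesis.ValiantsHypothesis.Theorems.KSPipelinePer

end
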